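import Mathlib
import Summits.Ventures.PercRepro2.CoinBlockTheoremII

/-!
# The cleared gate functional is nonnegative whenever the gate law is log-supermodular and
dominates the `R`-law in its two marker means (blind cell PercRepro2, night-2 g10;
proofs/NIGHT2-DARC.md §41.10)

`blockMean_nonneg`: for two block systems `Λ_{xy}`, `M_{xy}` (the `R`-masses and the gate masses of
the four marker blocks) with `M` log-supermodular on the `2 × 2` lattice (`H2 : M₁₀M₀₁ ≤ M₀₀M₁₁`)
and the two MEAN ORDERINGS `Λ·M₁ ≥ Λ₁·M`, `Λ·M₂ ≥ Λ₂·M` (the gate law gives each marker at least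
the probability the `R`-law gives it — e.g. a consequence of the Holley order `M ≽ Λ`), the cleared
functional `Λ²M₁₁ − ΛΛ₁M₂ − ΛΛ₂M₁ + Λ₁Λ₂M` is nonnegative.  By the tilt identity
(`blockII_identity`) it is `M⁻¹·[Λ²(M₀₀M₁₁ − M₁₀M₀₁) + D₁D₂]` with both shifts `D₁, D₂ ≥ 0`.
This is the mechanism behind the mixed functional `Q(Λ⁰, Λ⁰; M¹) ≥ 0` of the DOM / SURE
splitting (§41.10) and generalises Block theorem II (where the mean orderings come from FKG).
Pure algebra, Mathlib only.
-/

namespace Summit.Ventures.PercRepro2.Coin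

section BlockMean

variable {R : Type*} [Field R] [LinearOrder R] [IsStrictOrderedRing R]

/-- **The gate functional is nonnegative under a log-supermodular gate law that dominates the
`R`-law in both marker means.** -/
theorem blockMean_nonneg (L00 L01 L10 L11 M00 M01 M10 M11 : R)
    (hM00 : 0 ≤ M00) (hM01 : 0 ≤ M01) (hM10 : 0 ≤ M10) (hM11 : 0 ≤ M11)
    (H2 : M10 * M01 ≤ M00 * M11)
    (hD1 : (L10 + L11) * (M00 + M01 + M10 + M11) ≤ (L00 + L01 + L10 + L11) * (M10 + M11))
    (hD2 : (L01 + L11) * (M00 + M01 + M10 + M11) ≤ (L00 + L01 + L10 + L11) * (M01 + M11)) :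
    0 ≤ (L00 + L01 + L10 + L11) ^ 2 * M11 - (L00 + L01 + L10 + L11) * (L10 + L11) * (M01 + M11) -
        (L00 + L01 + L10 + L11) * (L01 + L11) * (M10 + M11) +
        (L10 + L11) * (L01 + L11) * (M00 + M01 + M10 + M11) := by
  have hD1' : 0 ≤ (L00 + L01) * (M10 + M11) - (L10 + L11) * (M00 + M01) := by linarith
  have hD2' : 0 ≤ (L00 + L10) * (M01 + M11) - (L01 + L11) * (M00 + M10) := by linarith
  have hcov : 0 ≤ (L00 + L01 + L10 + L11) ^ 2 * (M00 * M11 - M10 * M01) :=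
    mul_nonneg (sq_nonneg _) (sub_nonneg.2 H2)
  have hM : 0 ≤ M00 + M01 + M10 + M11 := by linarith
  rcases hM.eq_or_lt with hM0 | hMpos
  · have e00 : M00 = 0 := by linarith
    have e01 : M01 = 0 := by linarith
    have e10 : M10 = 0 := by linarith
    have e11 : M11 = 0 := by linarith
    subst e00 e01 e10 e11
    simp
  · have key := blockII_identity L00 L01 L10 L11 M00 M01 M10 M11
    have hprod : 0 ≤ (M00 + M01 + M10 + M11) *
        ((L00 + L01 + L10 + L11) ^ 2 * M11 -
          (L00 + L01 + L10 + L11) * (L10 + L11) * (M01 + M11) -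
          (L00 + L01 + L10 + L11) * (L01 + L11) * (M10 + M11) +
          (L10 + L11) * (L01 + L11) * (M00 + M01 + M10 + M11)) := by
      rw [key]
      exact add_nonneg hcov (mul_nonneg hD1' hD2')
    exact (mul_nonneg_iff_of_pos_left hMpos).1 hprod

end BlockMean

end Summit.Ventures.PercRepro2.Coin
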